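import Mathlib.FieldTheory.PurelyInseparable.Basic
import HarnessLib

/-!
# `Pialt` (crux stmt-ResolutionOfSingularities-0555), line `SketchIdeator2`: one height-one step of a purely inseparable extension

Stub `exists_not_mem_range_pow_mem_range` (W2a of the lead's RRLU1 programme) of the lead's
skeleton `radicially-regular-endgame` (helper file,
`--supports stmt-ResolutionOfSingularities-0555`; does not close the item). It supplies the step
element of the induction on `[L : K]` that peels a finite purely inseparable extension one
height-one Frobenius sandwich at a time.

**Statement.** Let `p` be a prime and `L / K` a purely inseparable extension of fields of
characteristic `p`. If `K → L` is not surjective, there is `y ∈ L` outside the image of `K` with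
`y ^ p` inside the image of `K`.

**Proof.** Pick `x ∈ L` outside the image of `K`. By pure inseparability
(`IsPurelyInseparable.pow_mem`) some `x ^ p ^ n` lies in the image of `K`; let `n₀` be the least
such exponent. Then `n₀ ≠ 0` (as `x ^ p ^ 0 = x`), and `y := x ^ p ^ (n₀ - 1)` works: `y` is
outside the image by minimality of `n₀`, while `y ^ p = x ^ p ^ n₀` is inside. Mathlib only.
-/

set_option linter.dupNamespace false -- mandated namespace of this single-conjunct summit

namespace Summit.ResolutionOfSingularities.ResolutionOfSingularities.Theorems.Pialt.RadiciallyRegular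

/-- **One height-one step of a purely inseparable extension.** For a prime `p` and a purely
inseparable extension `L / K` of fields of characteristic `p` with `K → L` not surjective, some
`y ∈ L` lies outside the image of `K` while `y ^ p` lies inside it. (Take `x ∉ K`, the least
`n₀` with `x ^ p ^ n₀ ∈ K` (it exists by `IsPurelyInseparable.pow_mem` and is nonzero) and
put `y := x ^ p ^ (n₀ - 1)`.) Elementary; Mathlib only. -/
theorem exists_not_mem_range_pow_mem_range (p : ℕ) [Fact p.Prime] (K L : Type) [Field K]
    [Field L] [Algebra K L] [CharP K p] [IsPurelyInseparable K L]
    (h : ¬ Function.Surjective (algebraMap K L)) :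
    ∃ y : L, y ∉ (algebraMap K L).range ∧ y ^ p ∈ (algebraMap K L).range := by
  classical
  -- an element of `L` outside the image of `K`
  obtain ⟨x, hx⟩ : ∃ x : L, x ∉ (algebraMap K L).range :=
    not_forall.1 fun H ↦ h fun b ↦ RingHom.mem_range.1 (H b)
  -- some `p`-power tower of `x` lands in the image of `K` (pure inseparability)
  have hex : ∃ n : ℕ, x ^ p ^ n ∈ (algebraMap K L).range := IsPurelyInseparable.pow_mem K p x
  -- the least such exponent is nonzero, since `x ^ p ^ 0 = x` is outside the image
  have h0 : Nat.find hex ≠ 0 := by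
    intro h0
    have hmem := Nat.find_spec hex
    rw [h0, pow_zero, pow_one] at hmem
    exact hx hmem
  -- `y := x ^ p ^ (n₀ - 1)`: outside the image by minimality, `y ^ p = x ^ p ^ n₀` inside
  refine ⟨x ^ p ^ (Nat.find hex - 1), Nat.find_min hex (Nat.sub_one_lt h0), ?_⟩
  rw [← pow_mul, ← pow_succ, Nat.sub_one_add_one h0]
  exact Nat.find_spec hex

end Summit.ResolutionOfSingularities.ResolutionOfSingularities.Theorems.Pialt.RadiciallyRegular
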